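import Mathlib
import Summits.KontsevichZagierPeriods.Zeta5Search.Families.DualGapFlipStep
import HarnessLib
import HarnessLib.Audit

/-!
# ζ(5) search — Families: the charts from the gap chart to Brown–Zudilin's residue chart (charts 0–3 here,
# 4–6 and the PROOF of the base identity `DualBaseIdentity` in `Families/DualBaseChartsB`)

HONEST FRAMING: systematic search; no irrationality claim unless certified.  Cell `pub-zeta5`, certifier 2
(cert-2 g8, 2026-08-22).  Pure algebra in `ℤ[[r₁..r₅]]`; nothing about `ζ(5)`; no number of record moves.

WHAT.  `Families/DualGapFlipStep` proved that constant-term triviality of a torus chart `X^s = r^{γ s}·V(s)`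
propagates along an elementary change `Y^s = X^{μ s}(1 + X^ρ)^{a s}`.  Here the chain of SIX such changes from the
`r`-chart (fan triangulation of the octagon `w₀…w₆, w₇ = ∞` at `w₇`; `X = r`) to Brown–Zudilin's residue chart is
written out with exact integer data (`HOME/cert-2/g8/code/e10_flips.py`, `e11_chartdata.py`): flips `17→02`, `37→24`,
`57→46`, `27→04`, `47→06` (reaching `T_c = {02,04,06,24,46}`) and the half-flip `04→26` applied to the coordinates `02`,
`46` only; chart `k` has `γ`-matrix `G k` and unit-exponent matrix `N k` over the ten span units of
`Families/DualGapSeries` (`V k s = E (N k *ᵥ s)`); each step's unit `1 + X^ρ` is again a ratio of span units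
(`u01`, `u23`, `u45`, `u0123/u01`, `u012345/u0123`, `u0123·u2345/(u23·u012345)` — Plücker).  The last chart's monomial
with exponents `s(t) = (t₅, −t₃, t₁, t₂, t₄)` is exactly `r^{−cExp 0 t}·E(nExp 0 t)`, so
**`dualBaseIdentity_holds : DualBaseIdentity`** (`Families/DualExactTwelve`), and with it every conditional result of
cert-2 g8 becomes unconditional (see `Families/DualExactBridge`: `dexact_of_base`).
-/

noncomputable section

open MvPowerSeries Finset Matrix

namespace Summit.KontsevichZagierPeriods.Zeta5Search.Families.Cellular

namespace DualR

/-! ## Charts from integer matrices -/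

/-- `E v = 1` for the zero exponent vector `v` (stated with a hypothesis; used as `E_one_of 0 rfl`). -/
theorem E_one_of (v : Fin 10 → ℤ) (hv : v = 0) : E v = 1 := by
  subst hv; unfold E; simp

/-- `E` as a monoid homomorphism on `Multiplicative ℤ¹⁰`. -/
def Ehom : Multiplicative (Fin 10 → ℤ) →* S5ˣ where
  toFun v := E (Multiplicative.toAdd v)
  map_one' := E_one_of _ rfl
  map_mul' x y := by rw [toAdd_mul, E_add]

/-- `E(−v) = E(v)⁻¹`. -/
theorem E_neg (v : Fin 10 → ℤ) : E (-v) = (E v)⁻¹ :=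
  eq_inv_of_mul_eq_one_left (by rw [← E_add, neg_add_cancel, E_one_of 0 rfl])

/-- `E(n • v) = E(v)^n`. -/
theorem E_zsmul (n : ℤ) (v : Fin 10 → ℤ) : E (n • v) = E v ^ n := by
  have : E (n • v) = Ehom (Multiplicative.ofAdd (n • v)) := rfl
  rw [this, ofAdd_zsmul, map_zpow]; rfl

/-- The additive map `s ↦ M *ᵥ s`. -/
def gam {m : ℕ} (M : Matrix (Fin m) (Fin 5) ℤ) : (Fin 5 → ℤ) →+ (Fin m → ℤ) :=
  (Matrix.mulVecLin M).toAddMonoidHom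

/-- `gam M s = M *ᵥ s`. -/
@[simp] theorem gam_apply {m : ℕ} (M : Matrix (Fin m) (Fin 5) ℤ) (s : Fin 5 → ℤ) : gam M s = M *ᵥ s := rfl

/-- The unit part `s ↦ E(N *ᵥ s)` of a chart, as a monoid homomorphism. -/
def unitsOf (Nm : Matrix (Fin 10) (Fin 5) ℤ) : Multiplicative (Fin 5 → ℤ) →* S5ˣ :=
  Ehom.comp (AddMonoidHom.toMultiplicative (gam Nm))

/-- `unitsOf N (ofAdd s) = E (N *ᵥ s)`. -/
@[simp] theorem unitsOf_apply (Nm : Matrix (Fin 10) (Fin 5) ℤ) (s : Fin 5 → ℤ) :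
    unitsOf Nm (Multiplicative.ofAdd s) = E (Nm *ᵥ s) := rfl

/-- The dot product with a fixed integer vector, as an additive map. -/
def dotHom (b : Fin 5 → ℤ) : (Fin 5 → ℤ) →+ ℤ where
  toFun s := b ⬝ᵥ s
  map_zero' := dotProduct_zero b
  map_add' x y := dotProduct_add b x y

/-- A matrix with an integer left inverse gives an injective map. -/
theorem gam_injective_of_leftInverse (M P : Matrix (Fin 5) (Fin 5) ℤ) (h : P * M = 1) :
    Function.Injective (gam M) := by
  intro s s' hs
  have := congrArg (fun v => P *ᵥ v) hs
  simpa [Matrix.mulVec_mulVec, h] using this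

/-- Units algebra: `A·D = B·D + x·C·B` gives `A/B = 1 + x·(C/D)`. -/
theorem units_div_eq_one_add (A B C D : S5ˣ) (x : S5) (h : (A : S5) * D = B * D + x * C * B) :
    ((A * B⁻¹ : S5ˣ) : S5) = 1 + x * ((C * D⁻¹ : S5ˣ) : S5) := by
  have hB : (B : S5) * ((B⁻¹ : S5ˣ) : S5) = 1 := by rw [← Units.val_mul, mul_inv_cancel, Units.val_one]
  have hD : (D : S5) * ((D⁻¹ : S5ˣ) : S5) = 1 := by rw [← Units.val_mul, mul_inv_cancel, Units.val_one]
  rw [Units.val_mul, Units.val_mul]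
  linear_combination (((B⁻¹ : S5ˣ) : S5) * ((D⁻¹ : S5ˣ) : S5)) * h + (1 + x * (C : S5) * ((D⁻¹ : S5ˣ) : S5)) * hB
    + (-((A : S5) * ((B⁻¹ : S5ˣ) : S5)) + (B : S5) * ((B⁻¹ : S5ˣ) : S5)) * hD

/-- A monomial of `ℤ[[r]]` as a product of powers of the variables. -/
theorem monomial_eq_prod (α : Fin 5 →₀ ℕ) :
    (monomial α (1 : ℤ) : S5) = r 0 ^ α 0 * r 1 ^ α 1 * r 2 ^ α 2 * r 3 ^ α 3 * r 4 ^ α 4 := by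
  have hα : α = Finsupp.single 0 (α 0) + Finsupp.single 1 (α 1) + Finsupp.single 2 (α 2) + Finsupp.single 3 (α 3) +
      Finsupp.single 4 (α 4) := by
    ext j; fin_cases j <;> simp
  conv_lhs => rw [hα]
  simp only [r, MvPowerSeries.X_pow_eq, MvPowerSeries.monomial_mul_monomial, one_mul]

/-- Units algebra at the level of exponent vectors: `E(m⁺)E(n⁻) = E(m⁻)E(n⁻) + x·E(n⁺)E(m⁻)` gives
`E(m⁺ − m⁻) = 1 + x·E(n⁺ − n⁻)`. -/
theorem E_sub_eq_one_add (mp mn np nn : Fin 10 → ℤ) (x : S5)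
    (h : ((E mp : S5ˣ) : S5) * (E nn : S5ˣ) = (E mn : S5ˣ) * (E nn : S5ˣ) + x * (E np : S5ˣ) * (E mn : S5ˣ)) :
    ((E (mp - mn) : S5ˣ) : S5) = 1 + x * ((E (np - nn) : S5ˣ) : S5) := by
  rw [sub_eq_add_neg, sub_eq_add_neg, E_add, E_add, E_neg, E_neg]
  exact units_div_eq_one_add _ _ _ _ _ h

/-- **Generic chart step** for charts given by integer matrices: if chart `(G, N)` is CT-trivial and the step data
`(μ, P, b, ρ, α, m)` satisfy the flip hypotheses, the chart `(G·μ, N')` with `N' s = N(μ s) + (b·s)m` is CT-trivial. -/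
theorem ctTrivial_next (Gm : Matrix (Fin 5) (Fin 5) ℤ) (Nm : Matrix (Fin 10) (Fin 5) ℤ)
    (hC : CTTrivial (gam Gm) (unitsOf Nm)) (μ P : Matrix (Fin 5) (Fin 5) ℤ) (hP : P * μ = 1) (b ρ : Fin 5 → ℤ)
    (α : Fin 5 →₀ ℕ) (hα : α ≠ 0) (hρ : Gm *ᵥ ρ = zOf α) (m : Fin 10 → ℤ)
    (hflip : ∀ (s : Fin 5 → ℤ) (i : ℕ), 1 ≤ i → μ *ᵥ s + i • ρ = 0 → b ⬝ᵥ s = 0)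
    (hU : ((E m : S5ˣ) : S5) = 1 + monomial α (1 : ℤ) * ((E (Nm *ᵥ ρ) : S5ˣ) : S5))
    (Gm' : Matrix (Fin 5) (Fin 5) ℤ) (Nm' : Matrix (Fin 10) (Fin 5) ℤ) (hG' : Gm' = Gm * μ)
    (hN' : ∀ s, Nm' *ᵥ s = Nm *ᵥ (μ *ᵥ s) + (b ⬝ᵥ s) • m) :
    CTTrivial (gam Gm') (unitsOf Nm') := by
  intro s hs
  have step := ctTrivial_step (gam Gm) (unitsOf Nm) hC ρ α hα (by rw [gam_apply, hρ]) (gam μ)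
    (gam_injective_of_leftInverse μ P hP) (dotHom b) (fun s i hi h => hflip s i hi (by simpa using h)) (E m)
    (by rw [unitsOf_apply]; exact hU) s hs
  have e1 : gam Gm' s = gam Gm (gam μ s) := by simp [hG', Matrix.mulVec_mulVec]
  have e2 : (unitsOf Nm' (Multiplicative.ofAdd s) : S5) =
      (unitsOf Nm (Multiplicative.ofAdd (gam μ s)) : S5) * (((E m) ^ (dotHom b s) : S5ˣ) : S5) := by
    rw [unitsOf_apply, unitsOf_apply, gam_apply, hN', E_add, E_zsmul, Units.val_mul]; rfl
  rw [e1, e2]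
  exact step

/-- Chart 0 — the `r`-chart (`G = 1`, `N = 0`) — is CT-trivial. -/
theorem chart0 : CTTrivial (gam (1 : Matrix (Fin 5) (Fin 5) ℤ)) (unitsOf (0 : Matrix (Fin 10) (Fin 5) ℤ)) := by
  intro s hs
  rw [unitsOf_apply, Matrix.zero_mulVec, E_one_of 0 rfl, gam_apply, Matrix.one_mulVec]
  exact ctTrivial_id s hs

/-- `γ`-matrix of chart 0 (coordinates `(1, 7), (2, 7), (3, 7), (4, 7), (5, 7)`): column `j` = `r`-exponent of coordinate `j`. -/
def gMat0 : Matrix (Fin 5) (Fin 5) ℤ := !![1, 0, 0, 0, 0; 0, 1, 0, 0, 0; 0, 0, 1, 0, 0; 0, 0, 0, 1, 0; 0, 0, 0, 0, 1]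

/-- unit-exponent matrix of chart 0 over the ten span units `01,012,0123,12,12345,23,234,2345,45,012345`. -/
def nMat0 : Matrix (Fin 10) (Fin 5) ℤ := !![0, 0, 0, 0, 0; 0, 0, 0, 0, 0; 0, 0, 0, 0, 0; 0, 0, 0, 0, 0; 0, 0, 0, 0, 0; 0, 0, 0, 0, 0; 0, 0, 0, 0, 0; 0, 0, 0, 0, 0; 0, 0, 0, 0, 0; 0, 0, 0, 0, 0]

/-- `γ`-matrix of chart 1 (coordinates `(0, 2), (2, 7), (3, 7), (4, 7), (5, 7)`): column `j` = `r`-exponent of coordinate `j`. -/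
def gMat1 : Matrix (Fin 5) (Fin 5) ℤ := !![-1, 1, 0, 0, 0; 0, 1, 0, 0, 0; 0, 0, 1, 0, 0; 0, 0, 0, 1, 0; 0, 0, 0, 0, 1]

/-- unit-exponent matrix of chart 1 over the ten span units `01,012,0123,12,12345,23,234,2345,45,012345`. -/
def nMat1 : Matrix (Fin 10) (Fin 5) ℤ := !![0, -1, 0, 0, 0; 0, 0, 0, 0, 0; 0, 0, 0, 0, 0; 0, 0, 0, 0, 0; 0, 0, 0, 0, 0; 0, 0, 0, 0, 0; 0, 0, 0, 0, 0; 0, 0, 0, 0, 0; 0, 0, 0, 0, 0; 0, 0, 0, 0, 0]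

/-- `γ`-matrix of chart 2 (coordinates `(0, 2), (2, 4), (2, 7), (4, 7), (5, 7)`): column `j` = `r`-exponent of coordinate `j`. -/
def gMat2 : Matrix (Fin 5) (Fin 5) ℤ := !![-1, 0, 1, 0, 0; 0, 0, 1, 0, 0; 0, -1, 0, 1, 0; 0, 0, 0, 1, 0; 0, 0, 0, 0, 1]

/-- unit-exponent matrix of chart 2 over the ten span units `01,012,0123,12,12345,23,234,2345,45,012345`. -/
def nMat2 : Matrix (Fin 10) (Fin 5) ℤ := !![0, 0, -1, 0, 0; 0, 0, 0, 0, 0; 0, 0, 0, 0, 0; 0, 0, 0, 0, 0; 0, 0, 0, 0, 0; 0, 0, 1, -1, 0; 0, 0, 0, 0, 0; 0, 0, 0, 0, 0; 0, 0, 0, 0, 0; 0, 0, 0, 0, 0]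

/-- `γ`-matrix of chart 3 (coordinates `(0, 2), (2, 4), (2, 7), (4, 6), (4, 7)`): column `j` = `r`-exponent of coordinate `j`. -/
def gMat3 : Matrix (Fin 5) (Fin 5) ℤ := !![-1, 0, 1, 0, 0; 0, 0, 1, 0, 0; 0, -1, 0, 0, 1; 0, 0, 0, 0, 1; 0, 0, 0, -1, 0]

/-- unit-exponent matrix of chart 3 over the ten span units `01,012,0123,12,12345,23,234,2345,45,012345`. -/
def nMat3 : Matrix (Fin 10) (Fin 5) ℤ := !![0, 0, -1, 0, 0; 0, 0, 0, 0, 0; 0, 0, 0, 0, 0; 0, 0, 0, 0, 0; 0, 0, 0, 0, 0; 0, 0, 1, 0, -1; 0, 0, 0, 0, 0; 0, 0, 0, 0, 0; 0, 0, 0, 0, 1; 0, 0, 0, 0, 0]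

/-- `γ`-matrix of chart 4 (coordinates `(0, 2), (0, 4), (2, 4), (4, 6), (4, 7)`): column `j` = `r`-exponent of coordinate `j`. -/
def gMat4 : Matrix (Fin 5) (Fin 5) ℤ := !![0, -1, 0, 0, 1; 1, -1, 0, 0, 1; 0, 0, -1, 0, 1; 0, 0, 0, 0, 1; 0, 0, 0, -1, 0]

/-- unit-exponent matrix of chart 4 over the ten span units `01,012,0123,12,12345,23,234,2345,45,012345`. -/
def nMat4 : Matrix (Fin 10) (Fin 5) ℤ := !![0, 1, -1, 0, 0; 0, 0, 0, 0, 0; -1, 0, 1, 0, -1; 0, 0, 0, 0, 0; 0, 0, 0, 0, 0; 1, -1, 0, 0, 0; 0, 0, 0, 0, 0; 0, 0, 0, 0, 0; 0, 0, 0, 0, 1; 0, 0, 0, 0, 0]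

/-- `γ`-matrix of chart 5 (coordinates `(0, 2), (0, 4), (0, 6), (2, 4), (4, 6)`): column `j` = `r`-exponent of coordinate `j`. -/
def gMat5 : Matrix (Fin 5) (Fin 5) ℤ := !![0, 0, -1, 0, 0; 1, 0, -1, 0, 0; 0, 1, -1, -1, 0; 0, 1, -1, 0, 0; 0, 0, 0, 0, -1]

/-- unit-exponent matrix of chart 5 over the ten span units `01,012,0123,12,12345,23,234,2345,45,012345`. -/
def nMat5 : Matrix (Fin 10) (Fin 5) ℤ := !![0, 1, 0, -1, 0; 0, 0, 0, 0, 0; -1, 0, 1, 1, -1; 0, 0, 0, 0, 0; 0, 0, 0, 0, 0; 1, -1, 0, 0, 0; 0, 0, 0, 0, 0; 0, 0, 0, 0, 0; 0, 1, -1, 0, 0; 0, -1, 0, 0, 1]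

/-- `γ`-matrix of chart 6 (coordinates `(0, 2), (0, 4), (0, 6), (2, 4), (4, 6)`): column `j` = `r`-exponent of coordinate `j`. -/
def gMat6 : Matrix (Fin 5) (Fin 5) ℤ := !![0, 0, -1, 0, 0; 1, 0, -1, 0, 0; 0, 1, -1, -1, 0; 0, 1, -1, 0, 0; 0, 0, 0, 0, -1]

/-- unit-exponent matrix of chart 6 over the ten span units `01,012,0123,12,12345,23,234,2345,45,012345`. -/
def nMat6 : Matrix (Fin 10) (Fin 5) ℤ := !![0, 1, 0, -1, 0; 0, 0, 0, 0, 0; 0, 0, 1, 1, 0; 0, 0, 0, 0, 0; 0, 0, 0, 0, 0; 0, -1, 0, 0, -1; 0, 0, 0, 0, 0; 1, 0, 0, 0, 1; 0, 1, -1, 0, 0; -1, -1, 0, 0, 0]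

/-- Chart 0 is the `r`-chart. -/
theorem chart0_holds : CTTrivial (gam gMat0) (unitsOf nMat0) := by
  have h1 : gMat0 = 1 := by
    ext i j; fin_cases i <;> fin_cases j <;> simp [gMat0]
  have h2 : nMat0 = 0 := by
    ext i j; fin_cases i <;> fin_cases j <;> simp [nMat0]
  rw [h1, h2]; exact chart0

/-! ### Step 0: pivot coordinate 0 of chart 0 (flip `(1, 7)`) -/

/-- change-of-exponents matrix of step 0 (chart 1 basis → chart 0 basis). -/
def mu0 : Matrix (Fin 5) (Fin 5) ℤ := !![-1, 1, 0, 0, 0; 0, 1, 0, 0, 0; 0, 0, 1, 0, 0; 0, 0, 0, 1, 0; 0, 0, 0, 0, 1]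
/-- its integer inverse. -/
def muInv0 : Matrix (Fin 5) (Fin 5) ℤ := !![-1, 1, 0, 0, 0; 0, 1, 0, 0, 0; 0, 0, 1, 0, 0; 0, 0, 0, 1, 0; 0, 0, 0, 0, 1]
/-- exponents of the step unit `1 + X^ρ` on the new coordinates. -/
def b0 : Fin 5 → ℤ := ![0, -1, 0, 0, 0]
/-- the pivot. -/
def rho0 : Fin 5 → ℤ := ![1, 0, 0, 0, 0]
/-- `r`-exponent of the pivot. -/
def alpha0 : Fin 5 →₀ ℕ := Finsupp.equivFunOnFinite.symm ![1, 0, 0, 0, 0]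
/-- span-unit exponents of the step unit `1 + X^ρ`. -/
def m0 : Fin 10 → ℤ := ![1, 0, 0, 0, 0, 0, 0, 0, 0, 0]

/-- The step unit identity `E(m) = 1 + r^α·E(N ρ)` (a Plücker relation among span units). -/
theorem hU0 : ((E m0 : S5ˣ) : S5) = 1 + monomial alpha0 (1 : ℤ) * ((E (nMat0 *ᵥ rho0) : S5ˣ) : S5) := by
  have hm : m0 = (delta 0) - (0) := by funext i; fin_cases i <;> simp [m0, delta]
  have hn : nMat0 *ᵥ rho0 = (0) - (0) := by
    funext i; fin_cases i <;> simp [nMat0, rho0, Matrix.mulVec, dotProduct, Fin.sum_univ_five]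
  rw [hm, hn, monomial_eq_prod]
  refine E_sub_eq_one_add _ _ _ _ _ ?_
  simp [E_delta, E_one_of 0 rfl, alpha0, r]

/-- Chart 1 is CT-trivial. -/
theorem chart1_holds : CTTrivial (gam gMat1) (unitsOf nMat1) := by
  refine ctTrivial_next gMat0 nMat0 chart0_holds mu0 muInv0 ?_ b0 rho0 alpha0 ?_ ?_ m0 ?_ hU0
    gMat1 nMat1 ?_ ?_
  · ext i j; fin_cases i <;> fin_cases j <;> simp [Matrix.mul_apply, Fin.sum_univ_five, mu0, muInv0]
  · intro h; have := congrArg (fun f => f 0) h; simp [alpha0] at this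
  · funext j; fin_cases j <;> simp [gMat0, rho0, alpha0, zOf, Matrix.mulVec, dotProduct, Fin.sum_univ_five]
  · intro s i hi h
    have h0 := congrFun h 0; have h1 := congrFun h 1; have h2 := congrFun h 2; have h3 := congrFun h 3
    have h4 := congrFun h 4
    simp [mu0, rho0, dotProduct, Fin.sum_univ_five] at h0 h1 h2 h3 h4
    simp [b0, dotProduct, Fin.sum_univ_five]
    omega
  · ext i j; fin_cases i <;> fin_cases j <;> simp [Matrix.mul_apply, Fin.sum_univ_five, gMat0, gMat1, mu0]
  · intro s; funext i
    fin_cases i <;> simp [nMat0, nMat1, mu0, b0, m0, Matrix.mulVec, dotProduct, Fin.sum_univ_five]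

/-! ### Step 1: pivot coordinate 2 of chart 1 (flip `(3, 7)`) -/

/-- change-of-exponents matrix of step 1 (chart 2 basis → chart 1 basis). -/
def mu1 : Matrix (Fin 5) (Fin 5) ℤ := !![1, 0, 0, 0, 0; 0, 0, 1, 0, 0; 0, -1, 0, 1, 0; 0, 0, 0, 1, 0; 0, 0, 0, 0, 1]
/-- its integer inverse. -/
def muInv1 : Matrix (Fin 5) (Fin 5) ℤ := !![1, 0, 0, 0, 0; 0, 0, -1, 1, 0; 0, 1, 0, 0, 0; 0, 0, 0, 1, 0; 0, 0, 0, 0, 1]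
/-- exponents of the step unit `1 + X^ρ` on the new coordinates. -/
def b1 : Fin 5 → ℤ := ![0, 0, 1, -1, 0]
/-- the pivot. -/
def rho1 : Fin 5 → ℤ := ![0, 0, 1, 0, 0]
/-- `r`-exponent of the pivot. -/
def alpha1 : Fin 5 →₀ ℕ := Finsupp.equivFunOnFinite.symm ![0, 0, 1, 0, 0]
/-- span-unit exponents of the step unit `1 + X^ρ`. -/
def m1 : Fin 10 → ℤ := ![0, 0, 0, 0, 0, 1, 0, 0, 0, 0]

/-- The step unit identity `E(m) = 1 + r^α·E(N ρ)` (a Plücker relation among span units). -/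
theorem hU1 : ((E m1 : S5ˣ) : S5) = 1 + monomial alpha1 (1 : ℤ) * ((E (nMat1 *ᵥ rho1) : S5ˣ) : S5) := by
  have hm : m1 = (delta 5) - (0) := by funext i; fin_cases i <;> simp [m1, delta]
  have hn : nMat1 *ᵥ rho1 = (0) - (0) := by
    funext i; fin_cases i <;> simp [nMat1, rho1, Matrix.mulVec, dotProduct, Fin.sum_univ_five]
  rw [hm, hn, monomial_eq_prod]
  refine E_sub_eq_one_add _ _ _ _ _ ?_
  simp [E_delta, E_one_of 0 rfl, alpha1, r]

/-- Chart 2 is CT-trivial. -/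
theorem chart2_holds : CTTrivial (gam gMat2) (unitsOf nMat2) := by
  refine ctTrivial_next gMat1 nMat1 chart1_holds mu1 muInv1 ?_ b1 rho1 alpha1 ?_ ?_ m1 ?_ hU1
    gMat2 nMat2 ?_ ?_
  · ext i j; fin_cases i <;> fin_cases j <;> simp [Matrix.mul_apply, Fin.sum_univ_five, mu1, muInv1]
  · intro h; have := congrArg (fun f => f 2) h; simp [alpha1] at this
  · funext j; fin_cases j <;> simp [gMat1, rho1, alpha1, zOf, Matrix.mulVec, dotProduct, Fin.sum_univ_five]
  · intro s i hi h
    have h0 := congrFun h 0; have h1 := congrFun h 1; have h2 := congrFun h 2; have h3 := congrFun h 3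
    have h4 := congrFun h 4
    simp [mu1, rho1, dotProduct, Fin.sum_univ_five] at h0 h1 h2 h3 h4
    simp [b1, dotProduct, Fin.sum_univ_five]
    omega
  · ext i j; fin_cases i <;> fin_cases j <;> simp [Matrix.mul_apply, Fin.sum_univ_five, gMat1, gMat2, mu1]
  · intro s; funext i
    fin_cases i <;> simp [nMat1, nMat2, mu1, b1, m1, Matrix.mulVec, dotProduct, Fin.sum_univ_five]

/-! ### Step 2: pivot coordinate 4 of chart 2 (flip `(5, 7)`) -/

/-- change-of-exponents matrix of step 2 (chart 3 basis → chart 2 basis). -/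
def mu2 : Matrix (Fin 5) (Fin 5) ℤ := !![1, 0, 0, 0, 0; 0, 1, 0, 0, 0; 0, 0, 1, 0, 0; 0, 0, 0, 0, 1; 0, 0, 0, -1, 0]
/-- its integer inverse. -/
def muInv2 : Matrix (Fin 5) (Fin 5) ℤ := !![1, 0, 0, 0, 0; 0, 1, 0, 0, 0; 0, 0, 1, 0, 0; 0, 0, 0, 0, -1; 0, 0, 0, 1, 0]
/-- exponents of the step unit `1 + X^ρ` on the new coordinates. -/
def b2 : Fin 5 → ℤ := ![0, 0, 0, 0, 1]
/-- the pivot. -/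
def rho2 : Fin 5 → ℤ := ![0, 0, 0, 0, 1]
/-- `r`-exponent of the pivot. -/
def alpha2 : Fin 5 →₀ ℕ := Finsupp.equivFunOnFinite.symm ![0, 0, 0, 0, 1]
/-- span-unit exponents of the step unit `1 + X^ρ`. -/
def m2 : Fin 10 → ℤ := ![0, 0, 0, 0, 0, 0, 0, 0, 1, 0]

/-- The step unit identity `E(m) = 1 + r^α·E(N ρ)` (a Plücker relation among span units). -/
theorem hU2 : ((E m2 : S5ˣ) : S5) = 1 + monomial alpha2 (1 : ℤ) * ((E (nMat2 *ᵥ rho2) : S5ˣ) : S5) := by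
  have hm : m2 = (delta 8) - (0) := by funext i; fin_cases i <;> simp [m2, delta]
  have hn : nMat2 *ᵥ rho2 = (0) - (0) := by
    funext i; fin_cases i <;> simp [nMat2, rho2, Matrix.mulVec, dotProduct, Fin.sum_univ_five]
  rw [hm, hn, monomial_eq_prod]
  refine E_sub_eq_one_add _ _ _ _ _ ?_
  simp [E_delta, E_one_of 0 rfl, alpha2, r]

/-- Chart 3 is CT-trivial. -/
theorem chart3_holds : CTTrivial (gam gMat3) (unitsOf nMat3) := by
  refine ctTrivial_next gMat2 nMat2 chart2_holds mu2 muInv2 ?_ b2 rho2 alpha2 ?_ ?_ m2 ?_ hU2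
    gMat3 nMat3 ?_ ?_
  · ext i j; fin_cases i <;> fin_cases j <;> simp [Matrix.mul_apply, Fin.sum_univ_five, mu2, muInv2]
  · intro h; have := congrArg (fun f => f 4) h; simp [alpha2] at this
  · funext j; fin_cases j <;> simp [gMat2, rho2, alpha2, zOf, Matrix.mulVec, dotProduct, Fin.sum_univ_five]
  · intro s i hi h
    have h0 := congrFun h 0; have h1 := congrFun h 1; have h2 := congrFun h 2; have h3 := congrFun h 3
    have h4 := congrFun h 4
    simp [mu2, rho2, dotProduct, Fin.sum_univ_five] at h0 h1 h2 h3 h4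
    simp [b2, dotProduct, Fin.sum_univ_five]
    omega
  · ext i j; fin_cases i <;> fin_cases j <;> simp [Matrix.mul_apply, Fin.sum_univ_five, gMat2, gMat3, mu2]
  · intro s; funext i
    fin_cases i <;> simp [nMat2, nMat3, mu2, b2, m2, Matrix.mulVec, dotProduct, Fin.sum_univ_five]

end DualR

end Summit.KontsevichZagierPeriods.Zeta5Search.Families.Cellular
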